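import Literature.AlgebraicTopology.CharacteristicClasses.ProjectiveBundle
import HarnessLib

/-!
# The projective completion `P(ξ ⊕ ℂ)` of a complex vector bundle: sections at zero and infinity, local product structure

D. Husemoller, *Fibre Bundles* (3rd ed. 1994), Ch. 17 §2 (the projective bundle `P(η)` of a
vector bundle, Def. 2.1, applied to `η = ξ ⊕ θ¹`), in the use made of it for the EULER / FIRST
CHERN CLASS of a line bundle `ξ = λ` (Bott–Tu, *Differential Forms in Algebraic Topology*, §20
"the projectivization of `E ⊕ 1` compactifies each fibre of `E` by adding the hyperplane at
infinity"; Milnor–Stasheff §14 works with the pair `(E, E₀)` instead): the bundle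
`D = P(ξ ⊕ ℂ) → B` with fibre `ℙ(ξ_b ⊕ ℂ)` contains `E(ξ)` as the open set `{[v : 1]}`, the ZERO
SECTION `s₀(b) = [0 : 1]` and, for a LINE bundle, the SECTION AT INFINITY `s_∞(b) = [ξ_b : 0]`.

For a Mathlib vector bundle `E` (model fibre `F`, fibres `E b` abelian groups) we set up, on top of
`ProjectiveBundle.lean` (`P(η)` as a fibre bundle, `projTrivialization`):

* `ProjCompl F E = P(E ⊕ ℂ)`, the total space `TotalSpace (ℙ ℂ (F × ℂ)) (b ↦ ℙ ℂ (E b × ℂ))` with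
  its fibre-bundle structure (the completed bundle is Mathlib's `E ×ᵇ Trivial B ℂ`), projection
  `complProj`, fibre inclusions `complFibreIncl b`;
* the local product structure over the base set `U` of an atlas trivialisation `e` of `E`:
  `complTriv e = projTrivialization (e × 𝟙)`, acting by `⟨b, [v : t]⟩ ↦ (b, [e_b v : t])`
  (`complTriv_apply_mk`), and for `S ⊆ U` the homeomorphism
  `complLocalHomeomorph e hS : ↥(π⁻¹ S) ≃ₜ ↥S × ℙ(F ⊕ ℂ)` (Mathlib's `preimageHomeomorph`) with its
  formula on fibres (`complLocalHomeomorph_fibre`);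
* the zero section `complZero : C(B, P(E ⊕ ℂ))`, `b ↦ [0 : 1]`, mapped by every local product
  structure to the constant slice `[0 : 1]` (`complLocalHomeomorph_complZero`);
* for LINE bundles (`finrank F = 1`): the section at infinity `complInf : C(B, P(E ⊕ ℂ))`,
  `b ↦ [u : 0]` (`u ≠ 0` any vector of the line `E b`; independent of `u`, `mk_prod_zero_eq`),
  mapped by every local product structure to the constant slice `[f₀ : 0]`
  (`complLocalHomeomorph_complInf`).

Everything is proved; no named facts. This is the topological input of the Thom/Euler class of a
line bundle as an absolute class on `P(λ ⊕ ℂ)` (sequel files).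

## References

* D. Husemoller, *Fibre Bundles*, GTM 20, Springer 1994, Ch. 17 §2 Def. 2.1. [HusemollerFibreBundles1994]
* R. Bott, L. Tu, *Differential Forms in Algebraic Topology*, GTM 82, Springer 1982, §20 p. 270
  (projectivisation of `E ⊕ 1`). [BottTu1982]
-/

noncomputable section

open Function Set Filter Bundle Topology Trivialization
open scoped LinearAlgebra.Projectivization

universe u v

namespace Literature.AlgebraicTopology.CharacteristicClasses

section Completion

variable {B : Type u} [TopologicalSpace B] (F : Type v) [NormedAddCommGroup F] [NormedSpace ℂ F]
  [FiniteDimensional ℂ F]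
  (E : B → Type v) [∀ b, AddCommGroup (E b)] [∀ b, Module ℂ (E b)]
  [TopologicalSpace (TotalSpace F E)] [∀ b, TopologicalSpace (E b)] [FiberBundle F E] [VectorBundle ℂ F E]

/-- The fibres `E b ⊕ ℂ` of the completed bundle `ξ ⊕ θ¹` (Mathlib's `E ×ᵇ Trivial B ℂ`). [cite: HusemollerFibreBundles1994, Ch. 17 §2] -/
abbrev ComplFib : B → Type v := fun b ↦ E b × ℂ

/-- **The projective completion `P(ξ ⊕ ℂ)`**: total space of the bundle of projective lines /
spaces `ℙ(E b ⊕ ℂ)` (Husemoller Ch. 17 Def. 2.1 for `η = ξ ⊕ θ¹`). [cite: HusemollerFibreBundles1994, Ch. 17 Def. 2.1] -/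
abbrev ProjCompl : Type (max u v) := TotalSpace (ℙ ℂ (F × ℂ)) fun b ↦ ℙ ℂ (ComplFib E b)

/-- The bundle projection `P(ξ ⊕ ℂ) → B` as a continuous map. [cite: HusemollerFibreBundles1994, Ch. 17 Def. 2.1] -/
def complProj : C(ProjCompl F E, B) :=
  ⟨TotalSpace.proj, continuous_projProj ℂ (F × ℂ) (ComplFib E)⟩

/-- The projection is `proj`. [folklore] -/
@[simp]
theorem complProj_apply (p : ProjCompl F E) : complProj F E p = p.proj := rfl

/-- The inclusion of the fibre `ℙ(E b ⊕ ℂ)` over `b`. [folklore] -/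
def complFibreIncl (b : B) : C(ℙ ℂ (ComplFib E b), ProjCompl F E) where
  toFun ℓ := ⟨b, ℓ⟩
  continuous_toFun := continuous_projTotalSpaceMk ℂ (F × ℂ) (ComplFib E) b

/-- The fibre inclusion is `ℓ ↦ ⟨b, ℓ⟩`. [folklore] -/
@[simp]
theorem complFibreIncl_apply (b : B) (ℓ : ℙ ℂ (ComplFib E b)) : complFibreIncl F E b ℓ = ⟨b, ℓ⟩ := rfl

/-! ### The local product structure over an atlas trivialisation -/

/-- The canonical trivialisation of the trivial line bundle is in its atlas. [folklore] -/
instance memTrivializationAtlas_trivialization :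
    MemTrivializationAtlas (Bundle.Trivial.trivialization B ℂ) where
  out := mem_singleton _

variable {F E}
variable (e : Trivialization F (π F E)) [MemTrivializationAtlas e]

/-- `e × 𝟙`: the induced trivialisation of the completed bundle `ξ ⊕ θ¹`. [folklore] -/
abbrev prodTriv : Trivialization (F × ℂ) (π (F × ℂ) (ComplFib E)) :=
  e.prod (Bundle.Trivial.trivialization B ℂ)

omit [NormedSpace ℂ F] [FiniteDimensional ℂ F] [∀ b, Module ℂ (E b)] [∀ b, TopologicalSpace (E b)] [FiberBundle F E]
  [VectorBundle ℂ F E] [MemTrivializationAtlas e] in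
/-- Its base set is that of `e`. [folklore] -/
theorem prodTriv_baseSet : (prodTriv e).baseSet = e.baseSet :=
  inter_univ e.baseSet

omit [NormedSpace ℂ F] [FiniteDimensional ℂ F] [∀ b, Module ℂ (E b)] [∀ b, TopologicalSpace (E b)] [FiberBundle F E]
  [VectorBundle ℂ F E] [MemTrivializationAtlas e] in
/-- `e × 𝟙` acts by `(b, (v, t)) ↦ (b, (e_b v, t))`. [folklore] -/
theorem prodTriv_apply_snd (b : B) (v : E b) (t : ℂ) :
    (prodTriv e ⟨b, (v, t)⟩).2 = ((e ⟨b, v⟩).2, t) := rfl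

omit [FiniteDimensional ℂ F] in
/-- The fibre isomorphism of `e × 𝟙` at `b ∈ U` is `e_b × 𝟙`. [folklore] -/
theorem linEquivAt_prodTriv_apply {b : B} (hb : b ∈ e.baseSet) (w : E b × ℂ) :
    linEquivAt ℂ (F × ℂ) (ComplFib E) (prodTriv e) b w = (linEquivAt ℂ F E e b w.1, w.2) := by
  obtain ⟨v, t⟩ := w
  have hb' : b ∈ (prodTriv e).baseSet := by rw [prodTriv_baseSet]; exact hb
  rw [linEquivAt_apply _ hb', linEquivAt_apply _ hb]
  rfl

omit [FiniteDimensional ℂ F] in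
/-- The fibre isomorphism of `e × 𝟙` at `b ∈ U` equals `e_b × 𝟙` as a continuous linear equivalence.
[folklore] -/
theorem linEquivAt_prodTriv_eq {b : B} (hb : b ∈ e.baseSet) :
    linEquivAt ℂ (F × ℂ) (ComplFib E) (prodTriv e) b =
      (linEquivAt ℂ F E e b).prodCongr (ContinuousLinearEquiv.refl ℂ ℂ) := by
  refine ContinuousLinearEquiv.ext (funext fun w ↦ ?_)
  rw [linEquivAt_prodTriv_apply e hb]
  rfl

/-- **The local product structure `P(ξ ⊕ ℂ)|_U ≅ U × ℙ(F ⊕ ℂ)`** over the base set `U` of the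
atlas trivialisation `e` of `ξ`: the projectivisation of `e × 𝟙` (Husemoller Ch. 17 Def. 2.1).
[cite: HusemollerFibreBundles1994, Ch. 17 Def. 2.1] -/
abbrev complTriv : Trivialization (ℙ ℂ (F × ℂ)) (π (ℙ ℂ (F × ℂ)) fun b ↦ ℙ ℂ (ComplFib E b)) :=
  projTrivialization ℂ (F × ℂ) (ComplFib E) (prodTriv e)

/-- Its base set is that of `e`. [folklore] -/
theorem complTriv_baseSet : (complTriv e).baseSet = e.baseSet := by
  rw [projTrivialization_baseSet, prodTriv_baseSet]

/-- It acts by `⟨b, ℓ⟩ ↦ (b, ℙ(e_b × 𝟙) ℓ)` on `b ∈ U`. [cite: HusemollerFibreBundles1994, Ch. 17 Def. 2.1] -/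
theorem complTriv_apply {b : B} (hb : b ∈ e.baseSet) (ℓ : ℙ ℂ (ComplFib E b)) :
    complTriv e ⟨b, ℓ⟩ =
      (b, homeomorphOfContinuousLinearEquiv ((linEquivAt ℂ F E e b).prodCongr (ContinuousLinearEquiv.refl ℂ ℂ)) ℓ) := by
  rw [projTrivialization_apply]
  change (b, homeomorphOfContinuousLinearEquiv (linEquivAt ℂ (F × ℂ) (ComplFib E) (prodTriv e) b) ℓ) = _
  rw [linEquivAt_prodTriv_eq e hb]

omit [FiniteDimensional ℂ F] in
/-- `(e_b v, t) ≠ 0` for `(v, t) ≠ 0`. [folklore] -/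
theorem prod_linEquivAt_ne_zero (b : B) {v : E b} {t : ℂ} (h : ((v, t) : E b × ℂ) ≠ 0) :
    ((linEquivAt ℂ F E e b v, t) : F × ℂ) ≠ 0 := by
  intro h0
  rw [Prod.mk_eq_zero] at h0
  apply h
  rw [Prod.mk_eq_zero]
  exact ⟨(linEquivAt ℂ F E e b).injective (by rw [h0.1, map_zero]), h0.2⟩

/-- It acts by `⟨b, [v : t]⟩ ↦ (b, [e_b v : t])`. [cite: HusemollerFibreBundles1994, Ch. 17 Def. 2.1] -/
theorem complTriv_apply_mk {b : B} (hb : b ∈ e.baseSet) (v : E b) (t : ℂ) (h : ((v, t) : E b × ℂ) ≠ 0) :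
    complTriv e ⟨b, Projectivization.mk ℂ (v, t) h⟩ =
      (b, Projectivization.mk ℂ (linEquivAt ℂ F E e b v, t) (prod_linEquivAt_ne_zero e b h)) := by
  rw [complTriv_apply e hb]
  rfl

variable (F E) in
/-- `π⁻¹ S` for the completed bundle. [folklore] -/
abbrev complPreimage (S : Set B) : Set (ProjCompl F E) := TotalSpace.proj ⁻¹' S

/-- **`P(ξ ⊕ ℂ)|_S ≃ₜ S × ℙ(F ⊕ ℂ)` for `S` inside the base set of an atlas trivialisation**
(restriction of the local product structure; Mathlib's `Trivialization.preimageHomeomorph`).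
[cite: HusemollerFibreBundles1994, Ch. 17 Def. 2.1] -/
def complLocalHomeomorph {S : Set B} (hS : S ⊆ e.baseSet) : ↥(complPreimage F E S) ≃ₜ ↥S × ℙ ℂ (F × ℂ) :=
  (complTriv e).preimageHomeomorph (hS.trans (complTriv_baseSet e).symm.subset)

/-- The local homeomorphism on the fibre over `b ∈ S`: `⟨b, ℓ⟩ ↦ (b, ℙ(e_b × 𝟙) ℓ)`. [folklore] -/
theorem complLocalHomeomorph_apply_mk {S : Set B} (hS : S ⊆ e.baseSet) {b : B} (hb : b ∈ S)
    (ℓ : ℙ ℂ (ComplFib E b)) :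
    complLocalHomeomorph e hS ⟨⟨b, ℓ⟩, hb⟩ =
      (⟨b, hb⟩, homeomorphOfContinuousLinearEquiv
        ((linEquivAt ℂ F E e b).prodCongr (ContinuousLinearEquiv.refl ℂ ℂ)) ℓ) := by
  rw [complLocalHomeomorph, Trivialization.preimageHomeomorph_apply, complTriv_apply e (hS hb)]

/-- The first component of the local homeomorphism is the projection. [folklore] -/
theorem complLocalHomeomorph_fst {S : Set B} (hS : S ⊆ e.baseSet) (p : ↥(complPreimage F E S)) :
    ((complLocalHomeomorph e hS p).1 : B) = p.1.proj := by
  rw [complLocalHomeomorph, Trivialization.preimageHomeomorph_apply]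

/-! ### Points at zero and at infinity of a projective line `ℙ(V ⊕ ℂ)` -/

section Points

variable (V : Type*) [AddCommGroup V] [Module ℂ V]

/-- The origin `[0 : 1] ∈ ℙ(V ⊕ ℂ)`. [folklore] -/
def zeroPt : ℙ ℂ (V × ℂ) := Projectivization.mk ℂ ((0 : V), (1 : ℂ)) (by simp)

variable {V} in
/-- The point at infinity `[u : 0] ∈ ℙ(V ⊕ ℂ)` of a nonzero vector. [folklore] -/
def infPt (u : V) (hu : u ≠ 0) : ℙ ℂ (V × ℂ) := Projectivization.mk ℂ (u, (0 : ℂ)) (by simp [hu])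

variable {V} in
/-- **On a LINE all points at infinity coincide**: `[u : 0] = [u' : 0]`. [folklore] -/
theorem infPt_eq_infPt (hV : Module.finrank ℂ V = 1) {u u' : V} (hu : u ≠ 0) (hu' : u' ≠ 0) :
    infPt u hu = infPt u' hu' := by
  obtain ⟨c, hc⟩ := (finrank_eq_one_iff_of_nonzero' u' hu').1 hV u
  have hc0 : c ≠ 0 := by rintro rfl; exact hu (by rw [← hc, zero_smul])
  rw [infPt, infPt, Projectivization.mk_eq_mk_iff']
  exact ⟨c, by rw [Prod.smul_mk, hc, smul_zero]⟩

variable {V} in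
/-- A linear map `A × 𝟙` fixes the origin: `ℙ(A × 𝟙) [0 : 1] = [0 : 1]`. [folklore] -/
theorem map_prodMap_zeroPt {W : Type*} [AddCommGroup W] [Module ℂ W] (A : V →ₗ[ℂ] W) (hA : Injective A) :
    Projectivization.map (A.prodMap (LinearMap.id : ℂ →ₗ[ℂ] ℂ)) (hA.prodMap injective_id) (zeroPt V) = zeroPt W := by
  rw [zeroPt, Projectivization.map_mk]
  change Projectivization.mk ℂ (A 0, (1 : ℂ)) _ = _
  simp_rw [map_zero]
  rfl

variable {V} in
/-- A linear injection `A × 𝟙` maps `[u : 0]` to `[A u : 0]`. [folklore] -/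
theorem map_prodMap_infPt {W : Type*} [AddCommGroup W] [Module ℂ W] (A : V →ₗ[ℂ] W) (hA : Injective A)
    (u : V) (hu : u ≠ 0) :
    Projectivization.map (A.prodMap (LinearMap.id : ℂ →ₗ[ℂ] ℂ)) (hA.prodMap injective_id) (infPt u hu) =
      infPt (A u) (fun h ↦ hu (hA (by rw [h, map_zero]))) := by
  rw [infPt, Projectivization.map_mk]
  rfl

end Points

/-! ### The zero section -/

variable (F E)

/-- **The zero section `s₀ : B → P(ξ ⊕ ℂ)`, `b ↦ [0 : 1]`** (the image of the zero section of `ξ`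
under `E(ξ) ⊂ P(ξ ⊕ ℂ)`). [cite: BottTu1982, §20 p. 270] -/
def complZeroFun (b : B) : ProjCompl F E := ⟨b, zeroPt (E b)⟩

variable {F E} in
/-- In the local product structure the zero section is the constant slice `[0 : 1]`. [folklore] -/
theorem complTriv_complZeroFun {b : B} (hb : b ∈ e.baseSet) :
    complTriv e (complZeroFun F E b) = (b, zeroPt F) := by
  rw [complZeroFun, zeroPt, complTriv_apply_mk e hb]
  refine congrArg (Prod.mk b) ?_
  rw [zeroPt]
  congr 1
  rw [map_zero]

variable {F E} in
/-- Local form: on the base set of `e`, `s₀ = (complTriv e)⁻¹ ∘ (b ↦ (b, [0 : 1]))`. [folklore] -/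
theorem complZeroFun_eq_symm {b : B} (hb : b ∈ e.baseSet) :
    complZeroFun F E b = (complTriv e).toOpenPartialHomeomorph.symm (b, zeroPt F) := by
  have hsrc : complZeroFun F E b ∈ (complTriv e).source := by
    rw [(complTriv e).source_eq, complTriv_baseSet]
    exact hb
  rw [← complTriv_complZeroFun e hb]
  exact ((complTriv e).toOpenPartialHomeomorph.left_inv hsrc).symm

/-- A section given locally by `(local trivialisation)⁻¹ ∘ (b ↦ (b, q))` for a FIXED `q` is
continuous at the points of the base set. [folklore] -/
theorem continuousAt_of_eq_symm_const (s : B → ProjCompl F E)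
    (e : Trivialization (ℙ ℂ (F × ℂ)) (π (ℙ ℂ (F × ℂ)) fun b ↦ ℙ ℂ (ComplFib E b))) (q : ℙ ℂ (F × ℂ))
    {b₀ : B} (hb₀ : b₀ ∈ e.baseSet)
    (hs : ∀ b ∈ e.baseSet, s b = e.toOpenPartialHomeomorph.symm (b, q)) : ContinuousAt s b₀ := by
  have hcont : ContinuousOn (fun b ↦ e.toOpenPartialHomeomorph.symm (b, q)) e.baseSet := by
    refine e.toOpenPartialHomeomorph.continuousOn_symm.comp (continuous_id.prodMk continuous_const).continuousOn
      fun b hb ↦ ?_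
    rw [e.target_eq]
    exact ⟨hb, mem_univ _⟩
  have hmem : e.baseSet ∈ 𝓝 b₀ := e.open_baseSet.mem_nhds hb₀
  exact ((hcont.continuousAt hmem).congr (Filter.eventuallyEq_of_mem hmem fun b hb ↦ (hs b hb).symm))

/-- **The zero section is continuous.** [cite: BottTu1982, §20 p. 270] -/
theorem continuous_complZeroFun : Continuous (complZeroFun F E) := by
  rw [continuous_iff_continuousAt]
  intro b₀
  exact continuousAt_of_eq_symm_const F E (complZeroFun F E) (complTriv (trivializationAt F E b₀)) (zeroPt F)
    (by rw [complTriv_baseSet]; exact mem_baseSet_trivializationAt F E b₀)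
    fun b hb ↦ complZeroFun_eq_symm (trivializationAt F E b₀) (by rwa [complTriv_baseSet] at hb)

/-- **The zero section `s₀ ∈ C(B, P(ξ ⊕ ℂ))`.** [cite: BottTu1982, §20 p. 270] -/
def complZero : C(B, ProjCompl F E) := ⟨complZeroFun F E, continuous_complZeroFun F E⟩

/-- `s₀ b = ⟨b, [0 : 1]⟩`. [folklore] -/
@[simp]
theorem complZero_apply (b : B) : complZero F E b = ⟨b, zeroPt (E b)⟩ := rfl

/-- `π ∘ s₀ = 𝟙`. [folklore] -/
theorem complProj_comp_complZero : (complProj F E).comp (complZero F E) = ContinuousMap.id B := rfl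

variable {F E} in
/-- **In every local product structure the zero section is the constant slice `[0 : 1]`**:
`h_e (s₀ b) = (b, [0 : 1])`. [folklore] -/
theorem complLocalHomeomorph_complZero {S : Set B} (hS : S ⊆ e.baseSet) {b : B} (hb : b ∈ S) :
    complLocalHomeomorph e hS (⟨complZero F E b, hb⟩ : complPreimage F E S) = (⟨b, hb⟩, zeroPt F) := by
  rw [complLocalHomeomorph, Trivialization.preimageHomeomorph_apply]
  change ((⟨b, hb⟩ : ↥S), (complTriv e (complZeroFun F E b)).2) = _
  rw [complTriv_complZeroFun e (hS hb)]

/-! ### The section at infinity of a line bundle -/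

section Line

variable (hF : Module.finrank ℂ F = 1)
include hF

omit [FiniteDimensional ℂ F] [TopologicalSpace (TotalSpace F E)] [∀ b, TopologicalSpace (E b)] [FiberBundle F E]
  [VectorBundle ℂ F E] in
/-- A complex line has a nonzero vector. [folklore] -/
theorem exists_ne_zero_of_finrank_eq_one : ∃ f : F, f ≠ 0 := by
  haveI : Nontrivial F := Module.nontrivial_of_finrank_eq_succ hF
  exact exists_ne 0

/-- A fixed nonzero vector `f₀` of the model line `F`. [folklore] -/
def modelVec : F := (exists_ne_zero_of_finrank_eq_one F hF).choose

omit [FiniteDimensional ℂ F] in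
/-- `f₀ ≠ 0`. [folklore] -/
theorem modelVec_ne_zero : modelVec F hF ≠ 0 := (exists_ne_zero_of_finrank_eq_one F hF).choose_spec

omit [FiniteDimensional ℂ F] in
/-- The fibres of a line bundle are lines. [folklore] -/
theorem finrank_fibre_eq_one (b : B) : Module.finrank ℂ (E b) = 1 := by
  rw [(linEquivAt ℂ F E (trivializationAt F E b) b).toLinearEquiv.finrank_eq, hF]

/-- A nonzero vector `u_b ∈ E b` (the preimage of `f₀` under the canonical chart at `b`). [folklore] -/
def fibreVec (b : B) : E b := (linEquivAt ℂ F E (trivializationAt F E b) b).symm (modelVec F hF)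

omit [FiniteDimensional ℂ F] in
/-- `u_b ≠ 0`. [folklore] -/
theorem fibreVec_ne_zero (b : B) : fibreVec F E hF b ≠ 0 := fun h ↦
  modelVec_ne_zero F hF ((linEquivAt ℂ F E (trivializationAt F E b) b).symm.injective
    (h.trans (map_zero _).symm))

/-- **The section at infinity `s_∞ : B → P(λ ⊕ ℂ)`, `b ↦ [λ_b : 0]`** of a LINE bundle `λ` (the
hyperplane — here point — at infinity added to each fibre `λ_b` by the projective completion).
[cite: BottTu1982, §20 p. 270] -/
def complInfFun (b : B) : ProjCompl F E := ⟨b, infPt (fibreVec F E hF b) (fibreVec_ne_zero F E hF b)⟩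

omit [FiniteDimensional ℂ F] in
/-- `s_∞ b = ⟨b, [u : 0]⟩` for ANY nonzero `u ∈ λ_b`. [folklore] -/
theorem complInfFun_eq (b : B) {u : E b} (hu : u ≠ 0) : complInfFun F E hF b = ⟨b, infPt u hu⟩ :=
  congrArg (TotalSpace.mk b) (infPt_eq_infPt (finrank_fibre_eq_one F E hF b) _ _)

variable {F E} in
/-- In the local product structure the section at infinity is the constant slice `[f₀ : 0]`. [folklore] -/
theorem complTriv_complInfFun {b : B} (hb : b ∈ e.baseSet) :
    complTriv e (complInfFun F E hF b) = (b, infPt (modelVec F hF) (modelVec_ne_zero F hF)) := by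
  rw [complInfFun, infPt, complTriv_apply_mk e hb]
  have hu : linEquivAt ℂ F E e b (fibreVec F E hF b) ≠ 0 := fun h0 ↦
    fibreVec_ne_zero F E hF b ((linEquivAt ℂ F E e b).injective (h0.trans (map_zero _).symm))
  exact congrArg (Prod.mk b) (infPt_eq_infPt hF hu (modelVec_ne_zero F hF))

variable {F E} in
/-- Local form: on the base set of `e`, `s_∞ = (complTriv e)⁻¹ ∘ (b ↦ (b, [f₀ : 0]))`. [folklore] -/
theorem complInfFun_eq_symm {b : B} (hb : b ∈ e.baseSet) :
    complInfFun F E hF b =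
      (complTriv e).toOpenPartialHomeomorph.symm (b, infPt (modelVec F hF) (modelVec_ne_zero F hF)) := by
  have hsrc : complInfFun F E hF b ∈ (complTriv e).source := by
    rw [(complTriv e).source_eq, complTriv_baseSet]
    exact hb
  rw [← complTriv_complInfFun e hF hb]
  exact ((complTriv e).toOpenPartialHomeomorph.left_inv hsrc).symm

/-- **The section at infinity is continuous.** [cite: BottTu1982, §20 p. 270] -/
theorem continuous_complInfFun : Continuous (complInfFun F E hF) := by
  rw [continuous_iff_continuousAt]
  intro b₀
  exact continuousAt_of_eq_symm_const F E (complInfFun F E hF) (complTriv (trivializationAt F E b₀))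
    (infPt (modelVec F hF) (modelVec_ne_zero F hF))
    (by rw [complTriv_baseSet]; exact mem_baseSet_trivializationAt F E b₀)
    fun b hb ↦ complInfFun_eq_symm (trivializationAt F E b₀) hF (by rwa [complTriv_baseSet] at hb)

/-- **The section at infinity `s_∞ ∈ C(B, P(λ ⊕ ℂ))`** of a line bundle. [cite: BottTu1982, §20 p. 270] -/
def complInf : C(B, ProjCompl F E) := ⟨complInfFun F E hF, continuous_complInfFun F E hF⟩

/-- `s_∞ b = ⟨b, [u_b : 0]⟩`. [folklore] -/
theorem complInf_apply (b : B) :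
    complInf F E hF b = ⟨b, infPt (fibreVec F E hF b) (fibreVec_ne_zero F E hF b)⟩ := rfl

/-- `π ∘ s_∞ = 𝟙`. [folklore] -/
theorem complProj_comp_complInf : (complProj F E).comp (complInf F E hF) = ContinuousMap.id B := rfl

variable {F E} in
/-- **In every local product structure the section at infinity is the constant slice `[f₀ : 0]`**:
`h_e (s_∞ b) = (b, [f₀ : 0])`. [folklore] -/
theorem complLocalHomeomorph_complInf {S : Set B} (hS : S ⊆ e.baseSet) {b : B} (hb : b ∈ S) :
    complLocalHomeomorph e hS (⟨complInf F E hF b, hb⟩ : complPreimage F E S) =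
      (⟨b, hb⟩, infPt (modelVec F hF) (modelVec_ne_zero F hF)) := by
  rw [complLocalHomeomorph, Trivialization.preimageHomeomorph_apply]
  change ((⟨b, hb⟩ : ↥S), (complTriv e (complInfFun F E hF b)).2) = _
  rw [complTriv_complInfFun e hF (hS hb)]

end Line

end Completion

end Literature.AlgebraicTopology.CharacteristicClasses
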